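import Literature.NumberTheory.Automorphic.PopaZagierHeckeElementProofs
import Literature.NumberTheory.Automorphic.PopaZagierOrbitSums
import HarnessLib

/-!
# The Popa–Zagier Hecke element `T̃_n`: finiteness, evenness, and property (A)

Proof-only companion of `PopaZagierHeckeElement` / `PopaZagierOrbitSums` (D-0026: theorems and
auxiliary definitions with bodies only). For `n > 0` let `ξ_n(M) = c(M) · 𝟙[det M = n]` be the
degree-`n` part `T̃_n` of the explicit Popa–Zagier element (13) of [PopaZagier2017]
(`coeffN n`, with `c = coeff` of `PopaZagierHeckeElement`). This file proves

* `coeff12_bounds` — a matrix in the support of `T̃` has positive determinant `n` and entries of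
  absolute value `≤ n` (loc. cit. Lemma 4(a): "`T̃ = ∑ T̃_n` with `T̃_n ∈ ℚ[M_n]`"), whence
  `finite_support_coeffN`;
* `coeff12_neg` — `c` is even (a function on matrices modulo `±1`);
* `heckeHyp_coeffN : HeckeHyp n (coeffN n)` — the hypotheses of `PopaZagierOrbitSums`
  (property (B) from `propB1`, `propB2`);
* `orbT_zeta0_coeffN_upper` — the evaluation `∑_k ζ₀(T^k H) = 1` for upper triangular `H` of
  determinant `n` with positive diagonal (`ζ₀ = (1 - S)T̃_n`): after normalising `0 ≤ b < d` by
  the shift invariance, only `k ∈ {-1, 0}` contribute and the two contributions add up to `1`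
  (a decidable identity in `(a, b, d)`);
* `orbT_zeta0_coeffN_eq` — **property (A) of [PopaZagier2017] for the explicit element**, in the
  orbit-sum form of `PopaZagierOrbitSums.HeckeHyp.orbT_zeta0_eq`: for every `M` of determinant
  `n`, `∑_k ζ₀(T^k M) = 𝟙[M₁₀ = 0] - 𝟙[M₁₁ = 0]`, i.e. all `Γ_∞`-orbit sums of
  `(1 - S)T̃_n - T_n^∞(1 - S)` vanish (loc. cit. Thm. 1 and Thm. 4: `T̃_n` satisfies (A)).

## References

* [PopaZagier2017] A. A. Popa, D. Zagier, J. reine angew. Math. 762 (2020), §1 (A), Thm. 1,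
  §4 Lemma 4(a), Thm. 4.
-/

namespace Literature.NumberTheory.Automorphic.PopaZagier

open Matrix

/-! ### Support and evenness of the coefficient function -/

/-- Support of `T₁`. [cite: PopaZagier2017, §4 (13)] -/
theorem wT1_ne_zero {a b c d : ℤ} (h : wT1 a b c d ≠ 0) : 0 ≤ c ∧ c < a ∧ a - d ≤ -b ∧ -b ≤ c := by
  unfold wT1 chainWeight3 at h
  split_ifs at h <;> omega

/-- Support of `T₂`. [cite: PopaZagier2017, §4 (13)] -/
theorem wT2_ne_zero {a b c d : ℤ} (h : wT2 a b c d ≠ 0) : b < d ∧ d ≤ 0 ∧ -b ≤ a - d ∧ a - d ≤ c := by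
  unfold wT2 chainWeight3 at h
  split_ifs at h <;> omega

/-- Support of `T₃`. [cite: PopaZagier2017, §4 (13)] -/
theorem wT3_ne_zero {a b c d : ℤ} (h : wT3 a b c d ≠ 0) :
    a ≤ 0 ∧ 0 < c ∧ 0 ≤ a - d ∧ a - d ≤ c ∧ c ≤ -b := by
  unfold wT3 chainWeight4 at h
  split_ifs at h <;> omega

/-- Support of `T₄`. [cite: PopaZagier2017, §4 (13)] -/
theorem wT4_ne_zero {a b c d : ℤ} (h : wT4 a b c d ≠ 0) :
    d ≤ 0 ∧ 0 < -b ∧ 0 ≤ a - d ∧ a - d ≤ -b ∧ -b ≤ c := by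
  unfold wT4 chainWeight4 at h
  split_ifs at h <;> omega

/-- Entry bounds on the support of `T₁`: positive determinant dominating all entries.
[cite: PopaZagier2017, Lemma 4(a)] -/
theorem bounds_of_wT1 {a b c d : ℤ} (h : wT1 a b c d ≠ 0) :
    0 < a * d - b * c ∧ |a| ≤ a * d - b * c ∧ |b| ≤ a * d - b * c ∧ |c| ≤ a * d - b * c ∧
      |d| ≤ a * d - b * c := by
  obtain ⟨hc0, hca, h1, h2⟩ := wT1_ne_zero h
  have ha : 0 < a := by omega
  have hd : 0 < d := by omega
  rw [abs_of_pos ha, abs_of_nonneg hc0, abs_of_pos hd]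
  rcases le_or_gt b 0 with hb | hb
  · rw [abs_of_nonpos hb]
    have hbc : 0 ≤ -b * c := mul_nonneg (by omega) hc0
    refine ⟨by nlinarith, by nlinarith, by nlinarith, by nlinarith, by nlinarith⟩
  · rw [abs_of_pos hb]
    have hda : a + b ≤ d := by omega
    have key : d * (a - c) + a * c ≤ a * d - b * c := by nlinarith
    have hac : 1 ≤ a - c := by omega
    have h3 : d ≤ d * (a - c) := by nlinarith
    refine ⟨by nlinarith, by nlinarith, by nlinarith, by nlinarith, by nlinarith⟩

/-- Entry bounds on the support of `T₂`. [cite: PopaZagier2017, Lemma 4(a)] -/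
theorem bounds_of_wT2 {a b c d : ℤ} (h : wT2 a b c d ≠ 0) :
    0 < a * d - b * c ∧ |a| ≤ a * d - b * c ∧ |b| ≤ a * d - b * c ∧ |c| ≤ a * d - b * c ∧
      |d| ≤ a * d - b * c := by
  obtain ⟨hbd, hd0, h1, h2⟩ := wT2_ne_zero h
  have ha : 0 < a := by omega
  have hc : 0 < c := by omega
  rw [abs_of_pos ha, abs_of_neg (by omega : b < 0), abs_of_pos hc, abs_of_nonpos hd0]
  -- `det = |b| c - a |d|`, `|b| ≥ |d| + 1`, `c ≥ a + |d|`
  have e1 : (-b) * c ≥ (-d + 1) * c := by nlinarith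
  have e2 : (-d + 1) * c ≥ (-d + 1) * (a - d) := by nlinarith
  refine ⟨by nlinarith, by nlinarith, by nlinarith, by nlinarith, by nlinarith⟩

/-- Entry bounds on the support of `T₃`. [cite: PopaZagier2017, Lemma 4(a)] -/
theorem bounds_of_wT3 {a b c d : ℤ} (h : wT3 a b c d ≠ 0) :
    0 < a * d - b * c ∧ |a| ≤ a * d - b * c ∧ |b| ≤ a * d - b * c ∧ |c| ≤ a * d - b * c ∧
      |d| ≤ a * d - b * c := by
  obtain ⟨ha0, hc0, h1, h2, h3⟩ := wT3_ne_zero h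
  rw [abs_of_nonpos ha0, abs_of_neg (by omega : b < 0), abs_of_pos hc0, abs_of_nonpos (by omega : d ≤ 0)]
  have had : 0 ≤ a * d := by nlinarith
  have hbc : c * c ≤ -b * c := by nlinarith
  have hcc : c ≤ c * c := by nlinarith
  refine ⟨by nlinarith, by nlinarith, by nlinarith, by nlinarith, ?_⟩
  rcases lt_or_ge a 0 with ha | ha
  · nlinarith
  · have : a = 0 := le_antisymm ha0 ha
    subst this
    nlinarith

/-- Entry bounds on the support of `T₄`. [cite: PopaZagier2017, Lemma 4(a)] -/
theorem bounds_of_wT4 {a b c d : ℤ} (h : wT4 a b c d ≠ 0) :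
    0 < a * d - b * c ∧ |a| ≤ a * d - b * c ∧ |b| ≤ a * d - b * c ∧ |c| ≤ a * d - b * c ∧
      |d| ≤ a * d - b * c := by
  obtain ⟨hd0, hb0, h1, h2, h3⟩ := wT4_ne_zero h
  rw [abs_of_neg (by omega : b < 0), abs_of_pos (by omega : 0 < c), abs_of_nonpos hd0]
  rcases le_or_gt a 0 with ha | ha
  · rw [abs_of_nonpos ha]
    have had : 0 ≤ a * d := by nlinarith
    have hbb : -b ≤ -b * c := by nlinarith
    have hbc2 : (-b) * (-b) ≤ -b * c := by nlinarith
    refine ⟨by nlinarith, by nlinarith, by nlinarith, by nlinarith, ?_⟩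
    rcases lt_or_ge a 0 with ha' | ha'
    · nlinarith
    · have : a = 0 := le_antisymm ha ha'
      subst this
      nlinarith
  · rw [abs_of_pos ha]
    -- `a ≥ 1`, `|b| ≥ a + |d|`, `c ≥ |b|`: `det = |b| c - a |d|`
    have e1 : (-b) * c ≥ (-b) * (-b) := by nlinarith
    have e2 : (-b) * (-b) ≥ (a - d) * (a - d) := by nlinarith
    have e3 : (-b) * (c + d) ≥ (-d + 1) * (c + d) := by nlinarith
    refine ⟨by nlinarith, by nlinarith, by nlinarith, by nlinarith, by nlinarith⟩

/-- Entry bounds on the support of the sign-normalised coefficient `pz13 = T₁ - T₂ - T₃ - T₄`.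
[cite: PopaZagier2017, Lemma 4(a)] -/
theorem bounds_of_pz13 {a b c d : ℤ} (h : pz13 a b c d ≠ 0) :
    0 < a * d - b * c ∧ |a| ≤ a * d - b * c ∧ |b| ≤ a * d - b * c ∧ |c| ≤ a * d - b * c ∧
      |d| ≤ a * d - b * c := by
  rw [pz13_eq] at h
  by_cases h1 : wT1 a b c d ≠ 0
  · exact bounds_of_wT1 h1
  by_cases h2 : wT2 a b c d ≠ 0
  · exact bounds_of_wT2 h2
  by_cases h3 : wT3 a b c d ≠ 0
  · exact bounds_of_wT3 h3
  by_cases h4 : wT4 a b c d ≠ 0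
  · exact bounds_of_wT4 h4
  push Not at h1 h2 h3 h4
  exact absurd (by rw [h1, h2, h3, h4]; ring) h

/-- **Lemma 4(a) of [PopaZagier2017] (support of `T̃`)**: a matrix `±(a b; c d)` with non-zero
coefficient in `T̃` has positive determinant `n = ad - bc`, and all its entries have absolute value
at most `n`; in particular each `T̃_n` is a finite sum. [cite: PopaZagier2017, Lemma 4(a)] -/
theorem coeff12_bounds {a b c d : ℤ} (h : coeff12 a b c d ≠ 0) :
    0 < a * d - b * c ∧ |a| ≤ a * d - b * c ∧ |b| ≤ a * d - b * c ∧ |c| ≤ a * d - b * c ∧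
      |d| ≤ a * d - b * c := by
  unfold coeff12 at h
  split_ifs at h with hs
  · exact bounds_of_pz13 h
  · have h' := bounds_of_pz13 h
    simp only [abs_neg, neg_mul_neg] at h'
    exact h'

set_option maxHeartbeats 4000000 in
set_option linter.unusedTactic false in
set_option linter.unreachableTactic false in
set_option linter.unusedSimpArgs false in
/-- **`T̃` is even**: `c(-M) = c(M)` (an element of `ℚ[M_n]`, matrices modulo `±1`).
[cite: PopaZagier2017, §1 ("modulo {±1}")] -/
theorem coeff12_neg (a b c d : ℤ) : coeff12 (-a) (-b) (-c) (-d) = coeff12 a b c d := by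
  unfold coeff12
  rcases lt_trichotomy c 0 with hc | hc | hc
  · rw [if_pos (by omega), if_neg (by omega)]
  · subst hc
    rcases lt_trichotomy a 0 with ha | ha | ha
    · rw [if_pos (by omega), if_neg (by omega)]
    · subst ha
      simp only [neg_zero, lt_self_iff_false, and_false, or_self, ↓reduceIte, neg_neg]
      unfold pz13 chainWeight3 chainWeight4
      (try simp (disch := omega) only [if_pos, if_neg, sub_zero, zero_sub, neg_neg, neg_zero,
        add_zero, zero_add, sub_self])
      repeat' (first | omega | (split <;> (try simp (disch := omega) only [if_pos, if_neg,
        sub_zero, zero_sub, neg_neg, neg_zero, add_zero, zero_add, sub_self])))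
    · rw [if_neg (by omega), if_pos (by omega)]
      simp only [neg_neg, neg_zero]
  · rw [if_neg (by omega), if_pos (by omega)]
    simp only [neg_neg]

/-! ### The degree-`n` part `T̃_n` as an element of `ℚ[M_n]` -/

/-- `ξ_n = T̃_n`: the coefficient function of the explicit element restricted to determinant `n`.
[cite: PopaZagier2017, Lemma 4(a)] -/
def coeffN (n : ℤ) (M : Mat) : ℚ := if M.det = n then coeff M else 0

/-- `T̃_n` is supported on `det = n`. [folklore] -/
theorem coeffN_det {n : ℤ} {M : Mat} (h : coeffN n M ≠ 0) : M.det = n := by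
  unfold coeffN at h
  by_contra h'
  exact h (if_neg h')

/-- `T̃_n` is even. [cite: PopaZagier2017, §1] -/
theorem coeffN_neg (n : ℤ) (M : Mat) : coeffN n (-M) = coeffN n M := by
  unfold coeffN coeff coeff12M
  rw [Matrix.det_neg]
  simp only [Fintype.card_fin, even_two, Even.neg_pow, one_pow, one_mul, Matrix.neg_apply,
    coeff12_neg]

/-- The support of `T̃_n` lies in the box of matrices with entries in `[-n, n]`; in particular it is
finite. [cite: PopaZagier2017, Lemma 4(a)] -/
theorem finite_support_coeffN (n : ℤ) : (Function.support (coeffN n)).Finite := by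
  classical
  let box : Finset ℤ := Finset.Icc (-n) n
  let F : Finset Mat := (box ×ˢ box ×ˢ box ×ˢ box).image fun p => !![p.1, p.2.1; p.2.2.1, p.2.2.2]
  refine (F.finite_toSet).subset ?_
  intro M hM
  simp only [Function.mem_support, ne_eq] at hM
  have hdet := coeffN_det hM
  have hc : coeff12 (M 0 0) (M 0 1) (M 1 0) (M 1 1) ≠ 0 := by
    intro h0
    apply hM
    unfold coeffN coeff coeff12M
    rw [h0]
    simp
  obtain ⟨-, ha, hb, hcc, hd⟩ := coeff12_bounds hc
  have hdet' : M 0 0 * M 1 1 - M 0 1 * M 1 0 = n := by rw [← hdet, Matrix.det_fin_two]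
  rw [hdet'] at ha hb hcc hd
  simp only [Finset.coe_image, Set.mem_image, Finset.mem_coe, Finset.mem_product, Finset.mem_Icc,
    Prod.exists, F, box]
  refine ⟨M 0 0, M 0 1, M 1 0, M 1 1, ⟨abs_le.mp ha, abs_le.mp hb, abs_le.mp hcc, abs_le.mp hd⟩, ?_⟩
  ext i j
  fin_cases i <;> fin_cases j <;> rfl

/-- `coeff` on an explicit product, entrywise. [folklore] -/
theorem coeff_eq (M : Mat) : coeff M = (coeff12 (M 0 0) (M 0 1) (M 1 0) (M 1 1) : ℚ) / 12 := rfl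

/-- **`T̃_n` satisfies the hypotheses of `PopaZagierOrbitSums`** (even, finitely supported on
`det = n`, property (B) from `propB1`/`propB2`). [cite: PopaZagier2017, Thm. 4(a)] -/
theorem heckeHyp_coeffN (n : ℤ) : HeckeHyp n (coeffN n) where
  even := coeffN_neg n
  finite := finite_support_coeffN n
  det_eq _ h := coeffN_det h
  propB1 M := by
    have hdS : (M * matS).det = M.det := by simp [Matrix.det_mul]
    have hdU : (matU * M).det = M.det := by simp [Matrix.det_mul]
    have hdUS : (matU * M * matS).det = M.det := by simp [Matrix.det_mul]
    unfold coeffN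
    rw [hdS, hdU, hdUS]
    split_ifs
    · simp only [coeff_eq, mul_apply_two, matS_apply00, matS_apply01, matS_apply10, matS_apply11,
        matU_apply00, matU_apply01, matU_apply10, matU_apply11, mul_zero, mul_one, zero_add,
        add_zero, mul_neg, one_mul, neg_mul, zero_mul]
      have h := propB1 (M 0 0) (M 0 1) (M 1 0) (M 1 1)
      have e1 : M 0 0 + -M 1 0 = M 0 0 - M 1 0 := by ring
      have e2 : M 0 1 + -M 1 1 = M 0 1 - M 1 1 := by ring
      rw [e1, e2, neg_sub, ← add_div, ← add_div]
      congr 1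
      exact_mod_cast h
    · simp
  propB2 M := by
    have hd1 : (M * matU).det = M.det := by simp [Matrix.det_mul]
    have hd2 : (M * matU * matU).det = M.det := by simp [Matrix.det_mul]
    have hd3 : (matS * M).det = M.det := by simp [Matrix.det_mul]
    have hd4 : (matS * M * matU).det = M.det := by simp [Matrix.det_mul]
    have hd5 : (matS * M * matU * matU).det = M.det := by simp [Matrix.det_mul]
    unfold coeffN
    rw [hd1, hd2, hd3, hd4, hd5]
    split_ifs
    · simp only [coeff_eq, mul_apply_two, matS_apply00, matS_apply01, matS_apply10, matS_apply11,
        matU_apply00, matU_apply01, matU_apply10, matU_apply11, mul_zero, mul_one, zero_add,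
        add_zero, mul_neg, one_mul, neg_mul, zero_mul]
      have h := propB2 (M 0 0) (M 0 1) (M 1 0) (M 1 1)
      rw [← add_div, ← add_div, ← add_div, ← add_div]
      congr 1
      ring_nf
      ring_nf at h
      exact_mod_cast h
    · simp

/-! ### The upper-triangular evaluation and property (A) -/

set_option maxHeartbeats 4000000 in
set_option linter.unusedTactic false in
set_option linter.unreachableTactic false in
set_option linter.unusedSimpArgs false in
/-- Above the strip `-d ≤ b' < d` both `c(a, b'; 0, d)` and `c(0, -d; a, b')` vanish (`a, d > 0`):
the case `b' ≥ d` (entries kept as variables with equational hypotheses so that the decision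
procedure never meets closed conditions such as `0 = 0`). [cite: PopaZagier2017, §4 (13)] -/
theorem coeff12_upper_eq_zero_of_le {a b c d e : ℤ} (ha : 0 < a) (hd : 0 < d) (hb : d ≤ b)
    (hc : c = 0) (he : e = -d) : coeff12 a b c d = 0 ∧ coeff12 c e a b = 0 := by
  constructor
  all_goals
    unfold coeff12 pz13 chainWeight3 chainWeight4
    (try simp (disch := omega) only [if_pos, if_neg, sub_zero, zero_sub, neg_neg, neg_zero,
      add_zero, zero_add, sub_self])
    repeat' (first | omega | (split <;> (try simp (disch := omega) only [if_pos, if_neg, sub_zero,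
      zero_sub, neg_neg, neg_zero, add_zero, zero_add, sub_self])))

set_option maxHeartbeats 4000000 in
set_option linter.unusedTactic false in
set_option linter.unreachableTactic false in
set_option linter.unusedSimpArgs false in
/-- Below the strip `-d ≤ b' < d` both `c(a, b'; 0, d)` and `c(0, -d; a, b')` vanish (`a, d > 0`):
the case `b' < -d`. [cite: PopaZagier2017, §4 (13)] -/
theorem coeff12_upper_eq_zero_of_lt {a b c d e : ℤ} (ha : 0 < a) (hd : 0 < d) (hb : b < -d)
    (hc : c = 0) (he : e = -d) : coeff12 a b c d = 0 ∧ coeff12 c e a b = 0 := by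
  constructor
  all_goals
    unfold coeff12 pz13 chainWeight3 chainWeight4
    (try simp (disch := omega) only [if_pos, if_neg, sub_zero, zero_sub, neg_neg, neg_zero,
      add_zero, zero_add, sub_self])
    repeat' (first | omega | (split <;> (try simp (disch := omega) only [if_pos, if_neg, sub_zero,
      zero_sub, neg_neg, neg_zero, add_zero, zero_add, sub_self])))

set_option maxHeartbeats 4000000 in
set_option linter.unusedTactic false in
set_option linter.unreachableTactic false in
set_option linter.unusedSimpArgs false in
/-- **The value `α = 1` on upper-triangular orbits**: for `a, d > 0` and `0 ≤ b < d` the two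
contributing terms `k = 0, -1` of `∑_k [c(a, b + kd; 0, d) - c(0, -d; a, b + kd)]` add up to
`12 · 1`. [cite: PopaZagier2017, Thm. 4(a) (property (A) for `T̃_n`)] -/
theorem coeff12_upper_sum {a b c d e b' : ℤ} (ha : 0 < a) (hd : 0 < d) (hb0 : 0 ≤ b) (hbd : b < d)
    (hc : c = 0) (he : e = -d) (hb' : b' = b - d) :
    coeff12 a b c d - coeff12 c e a b + (coeff12 a b' c d - coeff12 c e a b') = 12 := by
  unfold coeff12 pz13 chainWeight3 chainWeight4
  (try simp (disch := omega) only [if_pos, if_neg, sub_zero, zero_sub, neg_neg, neg_zero,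
    add_zero, zero_add, sub_self])
  repeat' (first | omega | (split <;> (try simp (disch := omega) only [if_pos, if_neg, sub_zero,
    zero_sub, neg_neg, neg_zero, add_zero, zero_add, sub_self])))

/-- The summand of the `Γ_∞`-orbit sum of `ζ₀ = (1 - S)T̃_n` over an upper-triangular matrix.
[cite: PopaZagier2017, §2] -/
theorem zeta0_coeffN_matT_mul_upper {n a b d : ℤ} (hn : a * d = n) (k : ℤ) :
    zeta0 (coeffN n) (matT k * !![a, b; 0, d]) =
      ((coeff12 a (b + k * d) 0 d - coeff12 0 (-d) a (b + k * d) : ℤ) : ℚ) / 12 := by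
  have e1 : matT k * !![a, b; 0, d] = !![a, b + k * d; 0, d] := by
    ext i j
    fin_cases i <;> fin_cases j <;> simp [mul_apply_two]
  have e2 : matS * !![a, b + k * d; 0, d] = !![0, -d; a, b + k * d] := by
    ext i j
    fin_cases i <;> fin_cases j <;> simp [mul_apply_two]
  have d1 : Matrix.det !![a, b + k * d; 0, d] = n := by
    rw [Matrix.det_fin_two_of]; rw [← hn]; ring
  have d2 : Matrix.det !![0, -d; a, b + k * d] = n := by
    rw [Matrix.det_fin_two_of]; rw [← hn]; ring
  unfold zeta0 coeffN
  rw [e1, e2, if_pos d1, if_pos d2, coeff_of, coeff_of]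
  push_cast
  ring

/-- **`α = 1`** for reduced upper-triangular matrices: `∑_k ζ₀(T^k (a b; 0 d)) = 1` for
`a, d > 0`, `0 ≤ b < d`, `ad = n`. [cite: PopaZagier2017, Thm. 4(a)] -/
theorem orbT_zeta0_coeffN_upper_reduced {n a b d : ℤ} (ha : 0 < a) (hd : 0 < d) (hb0 : 0 ≤ b)
    (hbd : b < d) (hn : a * d = n) : orbT (zeta0 (coeffN n)) !![a, b; 0, d] = 1 := by
  unfold orbT
  simp_rw [zeta0_coeffN_matT_mul_upper hn]
  rw [finsum_eq_sum_of_support_subset (s := ({-1, 0} : Finset ℤ))]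
  · rw [Finset.sum_pair (by norm_num)]
    simp only [neg_mul, one_mul, zero_mul, add_zero, ← sub_eq_add_neg]
    rw [← add_div]
    rw [div_eq_one_iff_eq (by norm_num)]
    have h := coeff12_upper_sum ha hd hb0 hbd rfl rfl rfl
    rw [add_comm]
    exact_mod_cast h
  · intro k hk
    rw [Function.mem_support] at hk
    simp only [Finset.coe_insert, Finset.coe_singleton, Set.mem_insert_iff, Set.mem_singleton_iff]
    by_contra hk'
    push Not at hk'
    apply hk
    rcases lt_or_gt_of_ne hk'.2 with hneg | hpos
    · have hk2 : k ≤ -2 := by omega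
      have hlt : b + k * d < -d := by nlinarith
      obtain ⟨h1, h2⟩ := coeff12_upper_eq_zero_of_lt ha hd hlt rfl rfl
      rw [h1, h2]; simp
    · have hk1 : 1 ≤ k := by omega
      have hle : d ≤ b + k * d := by nlinarith
      obtain ⟨h1, h2⟩ := coeff12_upper_eq_zero_of_le ha hd hle rfl rfl
      rw [h1, h2]; simp

/-- **`α = 1` on every upper-triangular `Γ_∞`-orbit of determinant `n > 0` with positive
diagonal** (the hypothesis `hup` of `HeckeHyp.orbT_zeta0_eq`), by reduction of `b` modulo `d`.
[cite: PopaZagier2017, Thm. 4(a)] -/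
theorem orbT_zeta0_coeffN_upper {n : ℤ} (hn : 0 < n) {H : Mat} (hdet : H.det = n)
    (hc : H 1 0 = 0) (ha : 0 < H 0 0) : orbT (zeta0 (coeffN n)) H = 1 := by
  have had : H 0 0 * H 1 1 = n := by rw [← hdet, Matrix.det_fin_two, hc]; ring
  have hd : 0 < H 1 1 := pos_of_mul_pos_right (had ▸ hn) ha.le
  set j : ℤ := -(H 0 1 / H 1 1) with hj
  have e : matT j * H = !![H 0 0, H 0 1 % H 1 1; 0, H 1 1] := by
    obtain ⟨h00, h01, h10, h11⟩ := matT_mul_apply j H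
    ext i k
    fin_cases i <;> fin_cases k
    · simpa [hc] using h00
    · simp only [Fin.zero_eta, Fin.mk_one, Matrix.of_apply, Matrix.cons_val', Matrix.cons_val_one,
        Matrix.cons_val_fin_one, Matrix.cons_val_zero]
      rw [h01, hj, Int.emod_def]; ring
    · simpa [hc] using h10
    · simpa using h11
  rw [← orbT_matT_mul _ j H, e]
  exact orbT_zeta0_coeffN_upper_reduced ha hd (Int.emod_nonneg _ hd.ne') (Int.emod_lt_of_pos _ hd)
    had

/-- **Property (A) of [PopaZagier2017] for the explicit element `T̃_n` (orbit-sum form).** For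
every integer matrix `M` of determinant `n > 0`,
`∑_{k ∈ ℤ} ζ₀(T^k M) = 𝟙[M₁₀ = 0] - 𝟙[M₁₁ = 0]`, where `ζ₀ = (1 - S)T̃_n`; equivalently all
`Γ_∞`-orbit sums of `(1 - S)T̃_n - T_n^∞(1 - S)` vanish, `T_n^∞ = ∑_{ad=n, 0≤b<d} (a b; 0 d)`.
This is the content of Theorems 1 and 4 of loc. cit. for the element (13), obtained here from
property (B) by the descent of the proof of Thm. 1 together with the direct evaluation
`orbT_zeta0_coeffN_upper` (Thm. 2 of loc. cit. is not needed).
[cite: PopaZagier2017, Thm. 1, Thm. 4] -/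
theorem orbT_zeta0_coeffN_eq {n : ℤ} (hn : 0 < n) {M : Mat} (hM : M.det = n) :
    orbT (zeta0 (coeffN n)) M = (if M 1 0 = 0 then 1 else 0) - (if M 1 1 = 0 then 1 else 0) :=
  (heckeHyp_coeffN n).orbT_zeta0_eq hn (fun _ hdet hc ha => orbT_zeta0_coeffN_upper hn hdet hc ha)
    hM

end Literature.NumberTheory.Automorphic.PopaZagier
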